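import Mathlib
import Summits.Ventures.PercRepro2.PendantBRow
import Summits.Ventures.PercRepro2.WAll
import Summits.Ventures.PercRepro2.MonoTPos
import Summits.Ventures.PercRepro2.PMK5Pendant
import Summits.Ventures.PercRepro2.PMK5PendantB
import Summits.Ventures.PercRepro2.PMK5LocusZeroI
import Summits.Ventures.PercRepro2.PMK5LocusZeroY

/-!
# THE SIX-VERTEX FAMILY `K₅ + a₃ PENDANT AT b`: the base masses, the four slacks, their signs, and the crux
functional in p1's Bernstein form on the base (blind cell PercRepro2, mine-2 g24; the first half of Theorem 20,
the locus theorems are in `PMK5LocusPendantB.lean`)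

In the `a₃`-free masses of `K₅` under `Q = {a₁ ↮ a₂}` (`Pm, bLm, bHm, oLm, oHm, Am, Bm, Cm, Ddm`; `Dm = P − bL − bH =
P(Q, b ∉ U)`) and the four BHK-1.4 slacks `ZL, ZH, YL, YH` (`≥ 0`, `PendantBRow.lean`), with `P > 0` and `D > 0` at every
weight vector with all weights `< 1` (`Pm_pos`, `Dm_pos`: the all-closed configuration), the crux functional on
`K5.PendantB.ends6b` is (**`gc6b_eq`**, `PendantB.Gc_pendant_b` + the transfer of `PMK5PendantB.lean`)
  `Gc(p) = (1 − q)² · 2P (Z_L + Z_H) + 2q(1 − q) · [(2bL + D) Z_L + (2bH + D) Z_H + P (Y_L + Y_H)] + q² · 2 [(2bL + D) Y_L + (2bH + D) Y_H]`.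
The two bridges to the kernel loci: **`twoPZ_eq_bern`** (`2P (Z_L + Z_H)` = the `a₃`-inactive form `Σ bern·2CI`, locus
`RuleA`) and **`Y_eq_bern`** (`Y_L + Y_H` = the `Y`-form of `PMK5KernelY.lean`, locus `RuleY`).  Standard axioms.
-/

namespace Summit.Ventures.PercRepro2

open Hub CovForm

namespace K5

namespace PM

section Masses

variable {R : Type*} [Field R] [LinearOrder R] [IsStrictOrderedRing R]

/-- `Q = {a₁ ↮ a₂}` on `K₅`. -/
abbrev Qev : Set (Config (Fin 10)) := avoidAll ends5 2 {1}

/-- `P = P(Q)`. -/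
noncomputable def Pm (s : Fin 10 → R) : R := prob s Qev
/-- `bL = P(Q, b ∈ C₁)`. -/
noncomputable def bLm (s : Fin 10 → R) : R := prob s (Qev ∩ connEvent ends5 1 4)
/-- `bH = P(Q, b ∈ C₂)`. -/
noncomputable def bHm (s : Fin 10 → R) : R := prob s (Qev ∩ connEvent ends5 2 4)
/-- `oL = P(Q, o ∈ C₁)`. -/
noncomputable def oLm (s : Fin 10 → R) : R := prob s (Qev ∩ connEvent ends5 1 0)
/-- `oH = P(Q, o ∈ C₂)`. -/
noncomputable def oHm (s : Fin 10 → R) : R := prob s (Qev ∩ connEvent ends5 2 0)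
/-- `A = P(Q, o ∈ C₁, b ∈ C₁)`. -/
noncomputable def Am (s : Fin 10 → R) : R := prob s (Qev ∩ (connEvent ends5 1 0 ∩ connEvent ends5 1 4))
/-- `B = P(Q, o ∈ C₂, b ∈ C₂)`. -/
noncomputable def Bm (s : Fin 10 → R) : R := prob s (Qev ∩ (connEvent ends5 2 0 ∩ connEvent ends5 2 4))
/-- `C = P(Q, o ∈ C₂, b ∈ C₁)`. -/
noncomputable def Cm (s : Fin 10 → R) : R := prob s (Qev ∩ (connEvent ends5 2 0 ∩ connEvent ends5 1 4))
/-- `Dd = P(Q, o ∈ C₁, b ∈ C₂)`. -/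
noncomputable def Ddm (s : Fin 10 → R) : R := prob s (Qev ∩ (connEvent ends5 1 0 ∩ connEvent ends5 2 4))
/-- `D = P − bL − bH = P(Q, b ∉ U)`. -/
noncomputable def Dm (s : Fin 10 → R) : R := Pm s - bLm s - bHm s
/-- The slack `Z_L = oL·bH − P·Dd`. -/
noncomputable def ZL (s : Fin 10 → R) : R := oLm s * bHm s - Pm s * Ddm s
/-- The slack `Z_H = oH·bL − P·C`. -/
noncomputable def ZH (s : Fin 10 → R) : R := oHm s * bLm s - Pm s * Cm s
/-- The slack `Y_L = bH (oL − A − Dd) − D·Dd`. -/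
noncomputable def YL (s : Fin 10 → R) : R := bHm s * (oLm s - Am s - Ddm s) - Dm s * Ddm s
/-- The slack `Y_H = bL (oH − B − C) − D·C`. -/
noncomputable def YH (s : Fin 10 → R) : R := bLm s * (oHm s - Bm s - Cm s) - Dm s * Cm s

variable (s : Fin 10 → R) (hs : IsProbVec s)
include hs

/-- `Z_L ≥ 0` (BHK 1.4). -/
lemma ZL_nonneg' : 0 ≤ ZL s := by
  have := PendantB.ZL_nonneg s ends5 hs 0 1 2 4
  unfold ZL oLm bHm Pm Ddm Qev; linarith
/-- `Z_H ≥ 0` (BHK 1.4). -/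
lemma ZH_nonneg' : 0 ≤ ZH s := by
  have := PendantB.ZH_nonneg s ends5 hs 0 1 2 4
  unfold ZH oHm bLm Pm Cm Qev; linarith
/-- `Y_L ≥ 0`. -/
lemma YL_nonneg' : 0 ≤ YL s := by
  have := PendantB.YL_nonneg s ends5 hs 0 1 2 4
  unfold YL Dm bHm oLm Am Ddm Pm bLm Qev; linarith
/-- `Y_H ≥ 0`. -/
lemma YH_nonneg' : 0 ≤ YH s := by
  have := PendantB.YH_nonneg s ends5 hs 0 1 2 4
  unfold YH Dm bLm oHm Bm Cm Pm bHm Qev; linarith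
/-- `D ≥ 0`. -/
lemma Dm_nonneg : 0 ≤ Dm s := by
  have := PendantB.bL_add_bH_le s ends5 hs 1 2 4
  unfold Dm Pm bLm bHm Qev; linarith
/-- `bL ≥ 0`. -/
lemma bLm_nonneg : 0 ≤ bLm s := prob_nonneg hs _
/-- `bH ≥ 0`. -/
lemma bHm_nonneg : 0 ≤ bHm s := prob_nonneg hs _
/-- `P ≥ 0`. -/
lemma Pm_nonneg : 0 ≤ Pm s := prob_nonneg hs _

omit hs in
/-- `D` is the mass of `PD = Q ∩ {b ∉ U}` at the third mark `b`. -/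
lemma Dm_eq_prob : Dm s = prob s (PDEvent ends5 1 2 4) := by
  rw [PendantB.prob_PD_b s ends5 1 2 4]; rfl

/-- **`P > 0` at every weight vector with all weights `< 1`** (the all-closed configuration lies in `Q`). -/
lemma Pm_pos (h1 : ∀ e, s e < 1) : 0 < Pm s := by
  unfold Pm Qev
  refine prob_pos_of_mem s hs (allClosed_mem_avoidAll ends5 (by decide)) ?_
  rw [weight_allClosed_eq]
  exact Finset.prod_pos fun e _ => sub_pos.2 (h1 e)

/-- **`D > 0` at every weight vector with all weights `< 1`** (the all-closed configuration lies in `PD`). -/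
lemma Dm_pos (h1 : ∀ e, s e < 1) : 0 < Dm s := by
  rw [Dm_eq_prob]
  refine prob_pos_of_mem s hs (ω := fun _ => false) ?_ ?_
  · show (fun _ => false : Config (Fin 10)) ∈ (connEvent ends5 1 2)ᶜ ∩ Dtilde ends5 1 2 4
    refine ⟨?_, ?_⟩
    · show ¬ Conn ends5 (fun _ => false) 1 2
      rw [conn_allClosed_iff]; decide
    · show (fun _ => false : Config (Fin 10)) ∉ UnionCluster.inU ends5 1 2 4
      simp only [UnionCluster.inU, Set.mem_union, mem_connEvent, conn_allClosed_iff, not_or]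
      decide
  · rw [weight_allClosed_eq]
    exact Finset.prod_pos fun e _ => sub_pos.2 (h1 e)

end Masses

/-! ## The Bernstein bridges of the two loci, in the masses -/

section Bridges

variable {R : Type*} [Field R] [LinearOrder R] [IsStrictOrderedRing R]

omit [LinearOrder R] [IsStrictOrderedRing R] in
/-- **`2P (Z_L + Z_H)` is the `a₃`-inactive Bernstein form** `Σ bern s k · 2 CI(k)`. -/
theorem twoPZ_eq_bern (s : Fin 10 → R) :
    2 * Pm s * (ZL s + ZH s) = ∑ k : Fin 10 → Fin 4, bern s k * (2 * Pendant.CI k) := by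
  unfold ZL ZH Pm oLm bHm Ddm oHm bLm Cm Qev
  rw [prob_eq_bform _ _ _ tQ_iff, prob_eq_bform _ _ _ tQBL_iff, prob_eq_bform _ _ _ Pendant.tQHo_iff',
    prob_eq_bform _ _ _ Pendant.tQBLHo_iff', prob_eq_bform _ _ _ tQB_iff, prob_eq_bform _ _ _ Pendant.tQLo_iff',
    prob_eq_bform _ _ _ Pendant.tQBLo_iff']
  have e : ∀ q oL bH Dd oH bL C : R, 2 * q * ((oL * bH - q * Dd) + (oH * bL - q * C)) =
      2 * (q * bL * oH + q * bH * oL - q * q * Dd - q * q * C) := by intros; ring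
  rw [e, bform_mul_mul, bform_mul_mul, bform_mul_mul, bform_mul_mul, ← Finset.sum_add_distrib,
    ← Finset.sum_sub_distrib, ← Finset.sum_sub_distrib, Finset.mul_sum]
  refine Finset.sum_congr rfl fun k _ => ?_
  rw [coef3_eq_cnt3, coef3_eq_cnt3, coef3_eq_cnt3, coef3_eq_cnt3]
  unfold Pendant.CI cntPosI cntNegI
  push_cast
  ring

omit [LinearOrder R] [IsStrictOrderedRing R] in
/-- **`Y_L + Y_H` is the `Y` Bernstein form** `Σ bern s k · (cntPosY k − cntNegY k)`. -/
theorem Y_eq_bern (s : Fin 10 → R) :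
    YL s + YH s = ∑ k, bern s k * ((cntPosY k : ℕ) - (cntNegY k : ℕ) : R) := by
  rw [← y_eq_bern]
  unfold YL YH Dm bHm oLm Am Ddm Pm bLm oHm Bm Cm Qev
  ring

end Bridges

/-! ## The family and its Bernstein form -/

section Family

variable {R : Type*} [Field R] [LinearOrder R] [IsStrictOrderedRing R]

omit [LinearOrder R] [IsStrictOrderedRing R] in
/-- The connection events among the marks transfer (numeral forms). -/
lemma c12b : connEvent PendantB.ends6b 1 2 = PendantB.resb ⁻¹' connEvent ends5 1 2 := by
  have h := PendantB.connEvent6b_eq 1 2; rwa [Pendant.cs1, Pendant.cs2] at h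
omit [LinearOrder R] [IsStrictOrderedRing R] in
/-- The connection events among the marks transfer (numeral forms). -/
lemma c14b : connEvent PendantB.ends6b 1 4 = PendantB.resb ⁻¹' connEvent ends5 1 4 := by
  have h := PendantB.connEvent6b_eq 1 4; rwa [Pendant.cs1, Pendant.cs4] at h
omit [LinearOrder R] [IsStrictOrderedRing R] in
/-- The connection events among the marks transfer (numeral forms). -/
lemma c24b : connEvent PendantB.ends6b 2 4 = PendantB.resb ⁻¹' connEvent ends5 2 4 := by
  have h := PendantB.connEvent6b_eq 2 4; rwa [Pendant.cs2, Pendant.cs4] at h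
omit [LinearOrder R] [IsStrictOrderedRing R] in
/-- The connection events among the marks transfer (numeral forms). -/
lemma c10b : connEvent PendantB.ends6b 1 0 = PendantB.resb ⁻¹' connEvent ends5 1 0 := by
  have h := PendantB.connEvent6b_eq 1 0; rwa [Pendant.cs1, Pendant.cs0] at h
omit [LinearOrder R] [IsStrictOrderedRing R] in
/-- The connection events among the marks transfer (numeral forms). -/
lemma c20b : connEvent PendantB.ends6b 2 0 = PendantB.resb ⁻¹' connEvent ends5 2 0 := by
  have h := PendantB.connEvent6b_eq 2 0; rwa [Pendant.cs2, Pendant.cs0] at h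
omit [LinearOrder R] [IsStrictOrderedRing R] in
/-- `Q` transfers. -/
lemma avoidAll6b : avoidAll PendantB.ends6b 2 {1} = PendantB.resb ⁻¹' avoidAll ends5 2 {1} := by
  rw [PMPendant.avoidAll_eq_compl, PMPendant.avoidAll_eq_compl, c12b, Set.preimage_compl]

omit [LinearOrder R] [IsStrictOrderedRing R] in
/-- The pendant edge of `ends6b` joins `a₃ = 5` to `b = 4`. -/
lemma ends6b_last' : PendantB.ends6b (Fin.last 10) = s(5, 4) := by
  rw [PendantB.ends6b_last, Sym2.eq_swap]

/-- **The crux functional on the family `K₅ + a₃ pendant at b`, in p1's Bernstein form on the base masses**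
(`q = p 10`, the masses at `s = p ∘ castSucc`). -/
theorem gc6b_eq (p : Fin 11 → R) :
    Gc p PendantB.ends6b 0 1 2 5 4 =
      (1 - p (Fin.last 10)) ^ 2 * (2 * Pm (p ∘ Fin.castSucc) * (ZL (p ∘ Fin.castSucc) + ZH (p ∘ Fin.castSucc))) +
        2 * p (Fin.last 10) * (1 - p (Fin.last 10)) *
          ((2 * bLm (p ∘ Fin.castSucc) + Dm (p ∘ Fin.castSucc)) * ZL (p ∘ Fin.castSucc) +
            (2 * bHm (p ∘ Fin.castSucc) + Dm (p ∘ Fin.castSucc)) * ZH (p ∘ Fin.castSucc) +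
            Pm (p ∘ Fin.castSucc) * (YL (p ∘ Fin.castSucc) + YH (p ∘ Fin.castSucc))) +
        p (Fin.last 10) ^ 2 * (2 * ((2 * bLm (p ∘ Fin.castSucc) + Dm (p ∘ Fin.castSucc)) * YL (p ∘ Fin.castSucc) +
          (2 * bHm (p ∘ Fin.castSucc) + Dm (p ∘ Fin.castSucc)) * YH (p ∘ Fin.castSucc))) := by
  rw [PendantB.Gc_pendant_b p PendantB.ends6b ends6b_last' PendantB.leaf_five_b (by decide) (by decide)
    (by decide) (by decide)]
  simp only [avoidAll6b, c14b, c24b, c10b, c20b, ← Set.preimage_inter, PendantB.prob_resb]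
  unfold ZL ZH YL YH Dm Pm bLm bHm oLm oHm Am Bm Cm Ddm Qev
  ring

end Family

end PM

end K5

end Summit.Ventures.PercRepro2
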